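import Literature.NumberTheory.EllipticCurves.PeriodIndexCassels
import HarnessLib

/-!
# Rational divisors on a torsor bound the index; `I ∣ P²`; Cassels' theorem reduced to the
# existence of a rational divisor of degree `P`

Sibling of `Literature/NumberTheory/EllipticCurves/PeriodIndexCassels` (Cassels' `I = P` on `Ш`,
Clark–Sharif 2010 §3.7 (ii); the named fact
`Literature.NumberTheory.EllipticCurves.Cassels1962_index_eq_period_of_mem_sha` of `PeriodIndex`).
This file formalises the **last step of both printed proofs of Cassels' theorem** (Clark 2006,
Prop. 6: "every rational divisor class on `C` admits a rational divisor. In particular, the period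
and index of `η` are equal"; O'Neil's obstruction map, property (a): "a class `η ∈ H¹(K, E)[n]` has
index dividing `n` iff some Kummer lift `ξ` of `η` has `Δ(ξ) = 0`", i.e. iff the torsor `C_η`
carries a `K`-rational divisor of degree `n`) in the tree's cocycle model of `H¹(K, E)`:

*a `K`-rational effective divisor of degree `d` on the torsor `C` of a class `η` forces
`I(η) ∣ d`.*

The torsor `C = C_c` of a continuous crossed homomorphism `c : Γ_K → E(K̄)` representing `η` has
`C(K̄) = E(K̄)` with the **twisted Galois action** `σ ⋆ Q = σ Q + c(σ)` (Silverman, *AEC*, X.§2–3: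
the twist of `E` by the cocycle `c`, Thm. X.3.6), so a `K`-rational effective divisor of degree
`d` on `C` is a finite multiset `D` of points of `E(K̄)` of cardinality `d` invariant under
`σ ⋆ ·`. The argument (Clark–Sharif 2010 §1.1: "In terms of `(C, ι)`, the index is the least
degree of a `K`-rational divisor", here the direction `I ∣ deg D`): the twisted
stabiliser `U_Q = {σ : σ Q + c(σ) = Q}` of a point `Q ∈ supp D` is an open subgroup of `Γ_K` of
index the size of the twisted orbit of `Q` (contained in `supp D`), and **`c` is principal on
`U_Q`** (`c(σ) = σ(-Q) - (-Q)` for `σ ∈ U_Q`), so `η` dies over the fixed field `K(Q) = K̄^{U_Q}`,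
of degree `[Γ_K : U_Q]`: every twisted orbit size in `supp D` is a splitting degree of `η`, and
`d = card D` is a sum of (multiples of) orbit sizes, hence divisible by `I(η)`.

## Main statements

* `index_mem_splittingDegrees_of_principalOn`: if `c` is principal on an open subgroup `U ≤ Γ_K`
  (`K` perfect) then `[Γ_K : U]` is a splitting degree of `[c]` — `[c]` dies over the fixed field
  `K̄^U` (Krull's correspondence, Mathlib's `InfiniteGalois.fixingSubgroup_fixedField`; the
  restriction to `K̄^U` is computed along a `K̄^U`-linear embedding of `K̄` into an algebraic
  closure of `K̄^U`, allowed by the tree's `WeierstrassCurve.localRestrictionKerOfEmb_eq_holds`).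
* `exists_twistStabilizer`, `isOpen_twistStabilizer`, `index_twistStabilizer_eq_card_orbit`,
  `index_dvd_index_twistStabilizer`: the twisted stabiliser of a point is an open subgroup, of
  index the cardinality of the twisted orbit, and `I([c])` divides that index.
* `index_dvd_card_of_twistInvariant` (multisets), `index_dvd_card_of_twistStable` (finite sets):
  **`I([c]) ∣ deg D` for every `K`-rational effective divisor `D` on the torsor of `c`.**
* `index_dvd_card_geomTorsion`, `index_dvd_sq_of_zsmul_eq_zero`, `index_dvd_addOrderOf_sq`:
  the `E[n]`-torsor of a Kummer lift is a rational divisor of degree `n²`, so **`I ∣ P²`**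
  (Clark–Sharif §1.3 eq. (1), second divisibility, "e.g. [WCII]"; classically Lang–Tate 1958) —
  this discharges the
  hypothesis `hIP` of `Literature.NumberTheory.EllipticCurves.ClarkSharif2010_thm2_of_primePow_torsion_index`
  (`ClarkSharif2010_thm2_of_primePow_torsion_index'`).
* `Cassels1962_index_eq_period_of_mem_sha_of_exists_rationalDivisor`: **Cassels' theorem follows
  from the existence, for every prime power `n` and every `ξ ∈ Sel^(n)(E/K)`, of a `K`-rational
  effective divisor of degree `n` on the torsor of `ξ`** — the exact remaining input, which is
  where the period-index obstruction `Δ(ξ) ∈ Br(K)[n]` and the reciprocity law for the Brauer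
  group of a number field enter (Clark 2006, Prop. 6; not available in Mathlib or the tree, and
  not vendored as a named fact, D-0026).

Everything here is proved; no definition and no named fact is introduced (the twisted action is
written out as `σ • Q + c σ`, twisted stabilisers are characterised by their membership
condition).

## References

* P. L. Clark, *There are genus one curves of every index over every number field*, J. reine
  angew. Math. 594 (2006) 201–206, Prop. 6 and its two proofs (`Clark2006Crelle`; arXiv
  math/0411413, pp. 3–5 read).
* P. L. Clark, S. Sharif, *Period, index and potential Ш*, Algebra Number Theory 4 (2010)
  151–174, §1.1 (index = least degree of a rational divisor), §1.3 eq. (1) (`P ∣ I ∣ P²`), §3.7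
  (ii) (`ClarkSharif2010`; arXiv:0811.3019 read).
* S. Lang, J. Tate, *Principal homogeneous spaces over abelian varieties*, Amer. J. Math. 80
  (1958) 659–684 (`LangTate1958`; NOT read — the divisibility `I ∣ P²` is cited through
  Clark–Sharif §1.3 eq. (1), who refer to [WCII] = P. L. Clark, *Period-index problems in
  WC-groups II: abelian varieties*).
* J. H. Silverman, *The Arithmetic of Elliptic Curves*, 2nd ed. (2009), X.§2 (twisting), X.§3
  (Thm. X.3.6: torsors ↔ `H¹(K, E)` via `σ ↦ p₀^σ - p₀`), VIII.§2 (Kummer sequence)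
  (`SilvermanAEC2009`).
* J.-P. Serre, *Galois Cohomology* (1997), I.§5.1 (principal cocycles), II.§1.1
  (`SerreGaloisCohomology1997`).
-/

noncomputable section

open scoped Classical

universe u

namespace Literature.NumberTheory.EllipticCurves

open GaloisRepresentations

/-! ### Classes principal on an open subgroup die over its fixed field -/

section SplitOverFixedField

variable {K : Type u} [Field K] (W : WeierstrassCurve K)

/-- For an intermediate field `F` of `K̄/K` and an `F`-linear embedding `ι : K̄ → F̄`
(`F̄ = AlgebraicClosure F`), the restriction `Γ_F → Γ_K` along `ι`
(`Literature.NumberTheory.EllipticCurves.resGalOfEmb`) lands in `Gal(K̄/F)`: `ι` maps `F ⊂ K̄`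
onto the canonical copy of `F` in `F̄`, which `Γ_F` fixes. Serre, *Galois Cohomology*, II.§1.1.
[folklore] -/
theorem resGalOfEmb_restrictScalars_mem_fixingSubgroup
    (F : IntermediateField K (AlgebraicClosure K))
    (ι : AlgebraicClosure K →ₐ[F] AlgebraicClosure F) (x : Field.absoluteGaloisGroup F) :
    resGalOfEmb (K := K) (ι.restrictScalars K) x ∈ F.fixingSubgroup := by
  refine (IntermediateField.mem_fixingSubgroup_iff _ _).mpr fun y hy ↦ ?_
  apply ι.toRingHom.injective
  change (ι.restrictScalars K) ((show AlgebraicClosure K ≃ₐ[K] AlgebraicClosure K from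
      resGalAuxOfEmb (ι.restrictScalars K) x) y) = ι y
  rw [apply_resGalAuxOfEmb_apply, AlgHom.restrictScalars_apply]
  have hy' : ι y = algebraMap F (AlgebraicClosure F) ⟨y, hy⟩ := ι.commutes ⟨y, hy⟩
  rw [hy']
  exact (show AlgebraicClosure F ≃ₐ[F] AlgebraicClosure F from x).commutes ⟨y, hy⟩

variable [PerfectField K]

/-- **A class principal on an open subgroup dies over its fixed field.** Let `K` be perfect,
`c : Γ_K → E(K̄)` a continuous crossed homomorphism and `U ≤ Γ_K` an open subgroup on which `c`
is principal (`c(u) = u a - a` for `u ∈ U`). Then `[Γ_K : U]` is a splitting degree of the class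
`[c] ∈ H¹(K, E)`: with `F = K̄^U` (so `Gal(K̄/F) = U` and `[F : K] = [Γ_K : U]`, Krull's
correspondence for the open subgroup `U`), the restriction of `[c]` to `H¹(F, E)` — computed along
an `F`-linear embedding `K̄ → F̄`, as allowed by `WeierstrassCurve.localRestrictionKerOfEmb_eq_holds`
— is the class of `c|_U` pulled back, a coboundary. Serre, *Galois Cohomology*, I.§5.1 and
II.§1.1; Clark–Sharif §1.1 (splitting degrees). [cite: ClarkSharif2010, §1.1]
[cite: SerreGaloisCohomology1997, I.§5.1] -/
theorem index_mem_splittingDegrees_of_principalOn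
    (c : contOneCocycles (discreteTopRep (Field.absoluteGaloisGroup K) (WeierstrassCurve.geomPoints W)))
    (U : Subgroup (Field.absoluteGaloisGroup K)) (hU : IsOpen (U : Set (Field.absoluteGaloisGroup K)))
    (a : WeierstrassCurve.geomPoints W) (ha : ∀ u ∈ U, c.1 u = u • a - a) :
    U.index ∈ splittingDegrees W (oneCocycleClass _ c) := by
  haveI : IsGalois K (AlgebraicClosure K) := {}
  let F : IntermediateField K (AlgebraicClosure K) := IntermediateField.fixedField U
  have hFU : F.fixingSubgroup = U :=
    InfiniteGalois.fixingSubgroup_fixedField ⟨U, U.isClosed_of_isOpen hU⟩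
  haveI hfd : FiniteDimensional K F := by
    rw [← InfiniteGalois.isOpen_iff_finite, hFU]
    exact hU
  have hrank : Module.finrank K F = U.index :=
    (IntermediateField.finrank_eq_fixingSubgroup_index F).trans (congrArg Subgroup.index hFU)
  haveI : Algebra.IsAlgebraic F (AlgebraicClosure K) := Algebra.IsAlgebraic.tower_top (K := K) F
  let ι₀ : AlgebraicClosure K →ₐ[F] AlgebraicClosure F := IsAlgClosed.lift
  let ι : AlgebraicClosure K →ₐ[K] AlgebraicClosure F := ι₀.restrictScalars K
  refine ⟨F, inferInstance, inferInstance, hfd, hrank, ?_⟩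
  rw [← WeierstrassCurve.localRestrictionKerOfEmb_eq_holds W F ι]
  change oneCocycleClass _ c ∈ resKer (resGalOfEmb ι) (pointsMapOfEmb W ι) (pointsMapOfEmb_smul W ι)
  rw [oneCocycleClass_mem_resKer_iff]
  refine ⟨pointsMapOfEmb W ι a, fun x ↦ ?_⟩
  have hx : resGalOfEmb ι x ∈ U := by
    rw [← hFU]
    exact resGalOfEmb_restrictScalars_mem_fixingSubgroup F ι₀ x
  rw [ha _ hx, map_sub, pointsMapOfEmb_smul]

end SplitOverFixedField

/-! ### The twisted Galois action of a cocycle: stabilisers and orbits -/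

section TwistedOrbit

variable {K : Type u} [Field K] (W : WeierstrassCurve K)
variable (c : contOneCocycles (discreteTopRep (Field.absoluteGaloisGroup K) (WeierstrassCurve.geomPoints W)))

/-- The twisted action `σ ⋆ Q = σ Q + c(σ)` of the trivial element is trivial (`c(1) = 0`).
Silverman, *AEC*, X.§2–3 (twisting by a cocycle). [folklore] -/
theorem twist_one (Q : WeierstrassCurve.geomPoints W) :
    (1 : Field.absoluteGaloisGroup K) • Q + c.1 1 = Q := by
  rw [one_smul, contOneCocycles.apply_one, add_zero]

/-- The twisted action is an action: `(σ τ) ⋆ Q = σ ⋆ (τ ⋆ Q)`, by the cocycle identity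
`c(σ τ) = c(σ) + σ c(τ)`. Silverman, *AEC*, X.§2–3. [folklore] -/
theorem twist_mul (g h : Field.absoluteGaloisGroup K) (Q : WeierstrassCurve.geomPoints W) :
    (g * h) • Q + c.1 (g * h) = g • (h • Q + c.1 h) + c.1 g := by
  rw [c.2 g h, discreteTopRep_ρ_apply, mul_smul, smul_add]
  abel

/-- Each `σ ⋆ ·` is injective on `E(K̄)`. [folklore] -/
theorem twist_injective (g : Field.absoluteGaloisGroup K) :
    Function.Injective fun Q : WeierstrassCurve.geomPoints W ↦ g • Q + c.1 g := fun _ _ h ↦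
  MulAction.injective g (add_right_cancel h)

/-- `σ⁻¹ ⋆ (σ ⋆ Q) = Q`. [folklore] -/
theorem twist_inv_twist (g : Field.absoluteGaloisGroup K) (Q : WeierstrassCurve.geomPoints W) :
    g⁻¹ • (g • Q + c.1 g) + c.1 g⁻¹ = Q := by
  rw [← twist_mul, inv_mul_cancel, twist_one]

/-- `σ ⋆ (σ⁻¹ ⋆ Q) = Q`. [folklore] -/
theorem twist_twist_inv (g : Field.absoluteGaloisGroup K) (Q : WeierstrassCurve.geomPoints W) :
    g • (g⁻¹ • Q + c.1 g⁻¹) + c.1 g = Q := by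
  rw [← twist_mul, mul_inv_cancel, twist_one]

/-- **The twisted stabiliser** `U_Q = {σ ∈ Γ_K : σ Q + c(σ) = Q}` of a point `Q ∈ E(K̄)` is a
subgroup of `Γ_K` (the stabiliser of `Q` for the twisted action `σ ⋆ Q = σ Q + c(σ)`, i.e. the
group of the field of definition `K(Q)` of the point `Q` of the torsor `C_c`). Stated as an
existence so that no definition is introduced. Silverman, *AEC*, X.§3 (fields of definition of the
points of a torsor). [folklore] -/
theorem exists_twistStabilizer (Q : WeierstrassCurve.geomPoints W) :
    ∃ U : Subgroup (Field.absoluteGaloisGroup K), ∀ g, g ∈ U ↔ g • Q + c.1 g = Q := by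
  let U : Subgroup (Field.absoluteGaloisGroup K) :=
    { carrier := {g | g • Q + c.1 g = Q}
      mul_mem' := fun {g h} hg hh ↦ by
        simp only [Set.mem_setOf_eq] at hg hh ⊢
        rw [twist_mul, hh, hg]
      one_mem' := twist_one W c Q
      inv_mem' := fun {g} hg ↦ by
        simp only [Set.mem_setOf_eq] at hg ⊢
        conv_lhs => rw [← hg]
        exact twist_inv_twist W c g Q }
  exact ⟨U, fun g ↦ Iff.rfl⟩

variable {c}

/-- `c` is principal on a twisted stabiliser: `c(u) = u(-Q) - (-Q)` for `u ∈ U_Q`.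
Serre, *Galois Cohomology*, I.§5.1; Silverman, *AEC*, X.§3 (proof of Thm. X.3.6: a rational
point makes the cocycle a coboundary). [folklore] -/
theorem principalOn_twistStabilizer {Q : WeierstrassCurve.geomPoints W}
    {U : Subgroup (Field.absoluteGaloisGroup K)} (hU : ∀ g, g ∈ U ↔ g • Q + c.1 g = Q) :
    ∀ u ∈ U, c.1 u = u • (-Q) - (-Q) := by
  intro u hu
  rw [hU] at hu
  rw [smul_neg, sub_neg_eq_add, neg_add_eq_sub, eq_sub_iff_add_eq, add_comm]
  exact hu

/-- **Twisted stabilisers are open**: `U_Q` contains the open neighbourhood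
`Stab(Q) ∩ c⁻¹(0)` of `1` (`E(K̄)` is a discrete `Γ_K`-module, `WeierstrassCurve.isOpen_stabilizer_point_holds`,
and `c` is continuous), and a subgroup containing a neighbourhood of `1` is open. Hence `K(Q)/K`
is finite. Serre, *Galois Cohomology*, II.§1.1. [folklore] -/
theorem isOpen_twistStabilizer {Q : WeierstrassCurve.geomPoints W}
    {U : Subgroup (Field.absoluteGaloisGroup K)} (hU : ∀ g, g ∈ U ↔ g • Q + c.1 g = Q) :
    IsOpen (U : Set (Field.absoluteGaloisGroup K)) := by
  apply U.isOpen_of_mem_nhds (g := 1)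
  have h1 : ((MulAction.stabilizer (Field.absoluteGaloisGroup K) Q : Set (Field.absoluteGaloisGroup K)) ∩
      (fun g ↦ c.1 g) ⁻¹' {0}) ∈ nhds (1 : Field.absoluteGaloisGroup K) := by
    refine IsOpen.mem_nhds ?_ ⟨?_, ?_⟩
    · exact (WeierstrassCurve.isOpen_stabilizer_point_holds W Q).inter
        (c.1.continuous.isOpen_preimage _ (isOpen_discrete _))
    · simp
    · rw [Set.mem_preimage, Set.mem_singleton_iff]
      exact contOneCocycles.apply_one c
  refine Filter.mem_of_superset h1 ?_
  rintro g ⟨hg1, hg2⟩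
  rw [SetLike.mem_coe, MulAction.mem_stabilizer_iff] at hg1
  rw [Set.mem_preimage, Set.mem_singleton_iff] at hg2
  rw [SetLike.mem_coe, hU, hg1, hg2, add_zero]

/-- The twisted orbit `{σ Q + c(σ)}` of `Q` is in bijection with `Γ_K ⧸ U_Q`, so its cardinality
is the index `[Γ_K : U_Q] = [K(Q) : K]` (orbit–stabiliser for the twisted action). [folklore] -/
theorem index_twistStabilizer_eq_card_orbit {Q : WeierstrassCurve.geomPoints W}
    {U : Subgroup (Field.absoluteGaloisGroup K)} (hU : ∀ g, g ∈ U ↔ g • Q + c.1 g = Q) :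
    U.index = Nat.card (Set.range fun g : Field.absoluteGaloisGroup K ↦ g • Q + c.1 g) := by
  have key : ∀ a b : Field.absoluteGaloisGroup K,
      QuotientGroup.leftRel U a b ↔ a • Q + c.1 a = b • Q + c.1 b := by
    intro a b
    rw [QuotientGroup.leftRel_apply, hU]
    constructor
    · intro h
      have h2 := congrArg (fun R ↦ a • R + c.1 a) h
      simp only at h2
      rw [← twist_mul, mul_inv_cancel_left] at h2
      exact h2.symm
    · intro h
      apply twist_injective W c a
      simp only
      rw [← twist_mul, mul_inv_cancel_left, h]
  exact Nat.card_congr ((Quotient.congrRight fun a b ↦ (key a b).trans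
    (Setoid.ker_def (f := fun g : Field.absoluteGaloisGroup K ↦ g • Q + c.1 g)).symm).trans
      (Setoid.quotientKerEquivRange _))

/-- The twisted orbit of `Q` is stable under the twisted action. [folklore] -/
theorem twist_mem_range {Q R : WeierstrassCurve.geomPoints W}
    (hR : R ∈ Set.range fun g : Field.absoluteGaloisGroup K ↦ g • Q + c.1 g)
    (g : Field.absoluteGaloisGroup K) :
    g • R + c.1 g ∈ Set.range fun g : Field.absoluteGaloisGroup K ↦ g • Q + c.1 g := by
  obtain ⟨h, rfl⟩ := hR
  exact ⟨g * h, twist_mul W c g h Q⟩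

/-- Membership in a twisted orbit is invariant under the twisted action. [folklore] -/
theorem twist_mem_range_iff {Q R : WeierstrassCurve.geomPoints W} (g : Field.absoluteGaloisGroup K) :
    (g • R + c.1 g ∈ Set.range fun g : Field.absoluteGaloisGroup K ↦ g • Q + c.1 g) ↔
      R ∈ Set.range fun g : Field.absoluteGaloisGroup K ↦ g • Q + c.1 g := by
  refine ⟨fun h ↦ ?_, fun h ↦ twist_mem_range W h g⟩
  have h' := twist_mem_range W h g⁻¹
  rwa [twist_inv_twist] at h'

variable [PerfectField K]

/-- **The index divides every twisted orbit size**: for a point `Q ∈ E(K̄)` with twisted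
stabiliser `U_Q`, `I([c]) ∣ [Γ_K : U_Q]` — `c` is principal on the open subgroup `U_Q`
(`principalOn_twistStabilizer`, `isOpen_twistStabilizer`), so `[Γ_K : U_Q] = [K(Q) : K]` is a
splitting degree of `[c]` (`index_mem_splittingDegrees_of_principalOn`): the torsor has a point
over `K(Q)`. Clark–Sharif §1.1 ("By Riemann-Roch, it is also the least degree of an extension `L/K`
such that `C` has an `L`-rational point" — here only: a point of `C` over `L = K(Q)` makes `[L : K]`
a splitting degree). [cite: ClarkSharif2010, §1.1] -/
theorem index_dvd_index_twistStabilizer {Q : WeierstrassCurve.geomPoints W}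
    {U : Subgroup (Field.absoluteGaloisGroup K)} (hU : ∀ g, g ∈ U ↔ g • Q + c.1 g = Q) :
    index W (oneCocycleClass _ c) ∣ U.index :=
  index_dvd_of_mem_splittingDegrees W
    (index_mem_splittingDegrees_of_principalOn W c U (isOpen_twistStabilizer W hU) (-Q)
      (principalOn_twistStabilizer W hU))

/-- **A rational effective divisor on the torsor bounds the index** (multiset form). Let
`c : Γ_K → E(K̄)` be a continuous crossed homomorphism over a perfect field `K` and `D` a finite
multiset of points of `E(K̄)` invariant under the twisted action `σ ⋆ Q = σ Q + c(σ)` (a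
`K`-rational effective divisor on the torsor `C_c`, `C_c(K̄) = E(K̄)` with the twisted action).
Then `I([c]) ∣ deg D = card D`: removing from `D` the twisted orbit of a point of its support,
with its (constant) multiplicity, leaves an invariant divisor of smaller degree, and each orbit
size is divisible by the index (`index_dvd_index_twistStabilizer`,
`index_twistStabilizer_eq_card_orbit`). This is the step "`C` has a rational divisor of degree
`n`, so `I ∣ n`" of Clark 2006, Prop. 6, and the direction `I ∣ deg D` of Clark–Sharif §1.1, "In
terms of `(C, ι)`, the index is the least degree of a `K`-rational divisor."
[cite: Clark2006Crelle, Prop. 6] [cite: ClarkSharif2010, §1.1] -/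
theorem index_dvd_card_of_twistInvariant (D : Multiset (WeierstrassCurve.geomPoints W))
    (hD : ∀ (g : Field.absoluteGaloisGroup K) (Q : WeierstrassCurve.geomPoints W),
      D.count (g • Q + c.1 g) = D.count Q) :
    index W (oneCocycleClass _ c) ∣ Multiset.card D := by
  suffices H : ∀ (n : ℕ) (D : Multiset (WeierstrassCurve.geomPoints W)), Multiset.card D = n →
      (∀ (g : Field.absoluteGaloisGroup K) (Q : WeierstrassCurve.geomPoints W),
        D.count (g • Q + c.1 g) = D.count Q) → index W (oneCocycleClass _ c) ∣ n from
    H _ D rfl hD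
  intro n
  induction n using Nat.strong_induction_on with
  | _ n ih =>
    intro D hn hD
    by_cases h0 : D = 0
    · subst h0
      rw [Multiset.card_zero] at hn
      rw [← hn]
      exact dvd_zero _
    obtain ⟨Q, hQ⟩ := Multiset.exists_mem_of_ne_zero h0
    obtain ⟨U, hU⟩ := exists_twistStabilizer W c Q
    -- the twisted orbit of `Q`, a finite set inside the support of `D`
    set f : Field.absoluteGaloisGroup K → WeierstrassCurve.geomPoints W := fun g ↦ g • Q + c.1 g
      with hf
    have hcount : ∀ g, D.count (f g) = D.count Q := fun g ↦ hD g Q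
    have hmemD : ∀ g, f g ∈ D := fun g ↦
      Multiset.count_pos.mp (by rw [hcount]; exact Multiset.count_pos.mpr hQ)
    let O : Finset (WeierstrassCurve.geomPoints W) := D.toFinset.filter fun R ↦ R ∈ Set.range f
    have hO : ∀ R, R ∈ O ↔ R ∈ Set.range f := fun R ↦ by
      simp only [O, Finset.mem_filter, Multiset.mem_toFinset, and_iff_right_iff_imp]
      rintro ⟨g, rfl⟩
      exact hmemD g
    have hOset : (O : Set (WeierstrassCurve.geomPoints W)) = Set.range f :=
      Set.ext fun R ↦ by rw [Finset.mem_coe, hO]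
    have hOcard : O.card = U.index := by
      rw [index_twistStabilizer_eq_card_orbit W hU, ← hf, ← hOset, Nat.card_coe_set_eq,
        Set.ncard_coe_finset]
    have hQO : Q ∈ O := (hO Q).mpr ⟨1, twist_one W c Q⟩
    -- the multiplicity `m` of `Q` in `D` is that of its whole orbit
    set m := D.count Q with hm
    have hmpos : 0 < m := Multiset.count_pos.mpr hQ
    have hcountO : ∀ R ∈ O, D.count R = m := fun R hR ↦ by
      obtain ⟨g, rfl⟩ := (hO R).mp hR
      exact hcount g
    -- remove `m` copies of the orbit
    have hle : m • O.val ≤ D := Multiset.le_iff_count.mpr fun R ↦ by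
      rw [Multiset.count_nsmul]
      by_cases hR : R ∈ O
      · rw [Multiset.count_eq_one_of_mem O.nodup hR, mul_one, hcountO R hR]
      · rw [Multiset.count_eq_zero.mpr (fun h ↦ hR h), mul_zero]
        exact Nat.zero_le _
    have hcardO : Multiset.card (m • O.val) = m * O.card := by
      rw [Multiset.card_nsmul, Finset.card_val]
    have hD' : ∀ (g : Field.absoluteGaloisGroup K) (R : WeierstrassCurve.geomPoints W),
        (D - m • O.val).count (g • R + c.1 g) = (D - m • O.val).count R := by
      intro g R
      rw [Multiset.count_sub, Multiset.count_sub, hD g R, Multiset.count_nsmul,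
        Multiset.count_nsmul]
      congr 2
      by_cases hR : R ∈ O
      · have hgR : g • R + c.1 g ∈ O := (hO _).mpr ((twist_mem_range_iff W g).mpr ((hO R).mp hR))
        rw [Multiset.count_eq_one_of_mem O.nodup hR, Multiset.count_eq_one_of_mem O.nodup hgR]
      · have hgR : g • R + c.1 g ∉ O := fun h ↦ hR ((hO R).mpr ((twist_mem_range_iff W g).mp ((hO _).mp h)))
        rw [Multiset.count_eq_zero.mpr (fun h ↦ hR h), Multiset.count_eq_zero.mpr (fun h ↦ hgR h)]
    have hsum : Multiset.card (D - m • O.val) + m * O.card = n := by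
      rw [Multiset.card_sub hle, hcardO, ← hn]
      exact Nat.sub_add_cancel (hcardO ▸ Multiset.card_le_card hle)
    have hlt : Multiset.card (D - m • O.val) < n := by
      have hOpos : 0 < O.card := Finset.card_pos.mpr ⟨Q, hQO⟩
      have := Nat.mul_pos hmpos hOpos
      omega
    rw [← hsum]
    refine dvd_add (ih _ hlt _ rfl hD') (Dvd.dvd.mul_left ?_ m)
    rw [hOcard]
    exact index_dvd_index_twistStabilizer W hU

/-- **A rational effective divisor on the torsor bounds the index** (reduced divisors): if a
finite set `S ⊂ E(K̄)` is stable under the twisted action `σ ⋆ Q = σ Q + c(σ)` then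
`I([c]) ∣ card S` (`index_dvd_card_of_twistInvariant` for the multiset of `S`).
[cite: Clark2006Crelle, Prop. 6] [cite: ClarkSharif2010, §1.1] -/
theorem index_dvd_card_of_twistStable (S : Finset (WeierstrassCurve.geomPoints W))
    (hS : ∀ (g : Field.absoluteGaloisGroup K), ∀ Q ∈ S, g • Q + c.1 g ∈ S) :
    index W (oneCocycleClass _ c) ∣ S.card := by
  have hiff : ∀ (g : Field.absoluteGaloisGroup K) (Q : WeierstrassCurve.geomPoints W),
      g • Q + c.1 g ∈ S ↔ Q ∈ S := fun g Q ↦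
    ⟨fun h ↦ by
      have h' := hS g⁻¹ _ h
      rwa [twist_inv_twist] at h', hS g Q⟩
  rw [← Finset.card_val]
  refine index_dvd_card_of_twistInvariant W S.val fun g Q ↦ ?_
  rw [Multiset.count_eq_of_nodup S.nodup, Multiset.count_eq_of_nodup S.nodup]
  simp only [Finset.mem_val, hiff]

end TwistedOrbit

/-! ### `I ∣ P²`: the `E[n]`-torsor of a Kummer lift is a rational divisor of degree `n²` -/

section IndexDvdSq

variable {K : Type u} [Field K] [PerfectField K] (W : WeierstrassCurve K)

/-- **`I([c]) ∣ #E[n]` for a cocycle with values in `E[n]`** (`E[n]` finite): the finite set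
`E[n] ⊂ E(K̄)` is stable under the twisted action `σ ⋆ Q = σ Q + c(σ)` (it is the `E[n]`-torsor
of the class of `c` in `H¹(K, E[n])`), so `index_dvd_card_of_twistStable` applies.
Clark–Sharif §1.3 eq. (1) (`I ∣ P²`). [cite: ClarkSharif2010, §1.3 eq. (1)] -/
theorem index_dvd_card_geomTorsion {n : ℤ} [Finite (WeierstrassCurve.geomTorsion W n)]
    (c : contOneCocycles (discreteTopRep (Field.absoluteGaloisGroup K) (WeierstrassCurve.geomPoints W)))
    (hc : ∀ g, c.1 g ∈ WeierstrassCurve.geomTorsion W n) :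
    index W (oneCocycleClass _ c) ∣ Nat.card (WeierstrassCurve.geomTorsion W n) := by
  have hfin : (WeierstrassCurve.geomTorsion W n : Set (WeierstrassCurve.geomPoints W)).Finite :=
    Set.toFinite _
  have hcard : Nat.card (WeierstrassCurve.geomTorsion W n) = hfin.toFinset.card := by
    rw [← SetLike.coe_sort_coe, Nat.card_coe_set_eq, Set.ncard_eq_toFinset_card _ hfin]
  rw [hcard]
  refine index_dvd_card_of_twistStable W hfin.toFinset fun g Q hQ ↦ ?_
  rw [Set.Finite.mem_toFinset, SetLike.mem_coe] at hQ ⊢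
  exact AddSubgroup.add_mem _ (smul_mem_torsionBy g hQ) (hc g)

/-- **`I(η) ∣ #E[n]` for `η` in the image of `H¹(K, E[n]) → H¹(K, E)`** (`E[n]` finite): a class
of `H¹(K, E[n])` is represented by a continuous cocycle with values in `E[n]`
(`Literature.NumberTheory.GaloisRepresentations.oneCocycleClass_surjective`), whose image is the
class of the same cocycle read in `E(K̄)` (`Literature.NumberTheory.GaloisRepresentations.map_oneCocycleClass`);
then `index_dvd_card_geomTorsion`. [cite: ClarkSharif2010, §1.3 eq. (1)] -/
theorem index_torsionH1ToH1_dvd_card_geomTorsion {n : ℤ} [Finite (WeierstrassCurve.geomTorsion W n)]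
    (ξ : W.galH1Torsion n) :
    index W (W.torsionH1ToH1 n ξ) ∣ Nat.card (WeierstrassCurve.geomTorsion W n) := by
  obtain ⟨ψ, rfl⟩ := oneCocycleClass_surjective
    (discreteTopRep (Field.absoluteGaloisGroup K) (WeierstrassCurve.geomTorsion W n)) ξ
  have hmap : W.torsionH1ToH1 n (oneCocycleClass _ ψ) =
      oneCocycleClass _ (contOneCocycles.pullback (ContinuousMonoidHom.id (Field.absoluteGaloisGroup K))
        (resHomOfEquivariant (ContinuousMonoidHom.id (Field.absoluteGaloisGroup K))
          (WeierstrassCurve.geomTorsion W n).subtype (fun _ _ ↦ rfl)) ψ) :=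
    map_oneCocycleClass _ _ _ ψ
  rw [hmap]
  exact index_dvd_card_geomTorsion W _ fun g ↦ (ψ.1 g).2

/-- **`I ∣ P²`, torsion form: a class of `H¹(K, E)` killed by `n` has index dividing `n²`** (for
`E` an elliptic curve over a perfect field `K` with `n ≠ 0` in `K`). The class lifts to
`H¹(K, E[n])` (Kummer sequence, the tree's `WeierstrassCurve.range_torsionH1ToH1_eq_torsionBy_holds`),
and `#E[n] = n²` (`WeierstrassCurve.card_torsionPoints_eq_sq_holds`, Silverman III.6.4(b)); then
`index_torsionH1ToH1_dvd_card_geomTorsion`: the `E[n]`-torsor of a Kummer lift is a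
`K`-rational effective divisor of degree `n²` on the torsor. "It is well known (e.g, [WCII])
that the period `P` and the index `I` of `C` satisfy the divisibilities `P ∣ I ∣ P²`"
(Clark–Sharif §1.3 eq. (1), citing [WCII]; classically Lang–Tate 1958).
[cite: ClarkSharif2010, §1.3 eq. (1)] -/
theorem index_dvd_sq_of_zsmul_eq_zero [W.IsElliptic] {n : ℕ} (hn : (n : K) ≠ 0) {η : W.galH1}
    (hη : (n : ℤ) • η = 0) : index W η ∣ n ^ 2 := by
  have hn0 : (n : ℤ) ≠ 0 := by
    rintro h
    exact hn (by rw [Int.natCast_eq_zero.mp h, Nat.cast_zero])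
  have hn' : ((n : ℕ) : AlgebraicClosure K) ≠ 0 := fun h0 ↦ hn <| by
    apply (algebraMap K (AlgebraicClosure K)).injective
    rw [map_natCast, map_zero, h0]
  have hcard : Nat.card (WeierstrassCurve.geomTorsion W (n : ℤ)) = n ^ 2 :=
    WeierstrassCurve.card_torsionPoints_eq_sq_holds W (AlgebraicClosure K) hn'
  haveI : Finite (WeierstrassCurve.geomTorsion W (n : ℤ)) :=
    Nat.finite_of_card_ne_zero (by rw [hcard]; exact pow_ne_zero _ (by rintro rfl; exact hn Nat.cast_zero))
  have hmem : η ∈ (W.torsionH1ToH1 n).range := by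
    rw [WeierstrassCurve.range_torsionH1ToH1_eq_torsionBy_holds W hn0]
    exact hη
  obtain ⟨ξ, rfl⟩ := hmem
  rw [← hcard]
  exact index_torsionH1ToH1_dvd_card_geomTorsion W ξ

end IndexDvdSq

section NumberField

variable {K : Type u} [Field K] [NumberField K] (W : WeierstrassCurve K)

/-- **`I ∣ P²`: the index of a class of `H¹(K, E)` divides the square of its
period**, for an elliptic curve `E` over a number field `K` — the second divisibility of "it is
well known (e.g, [WCII]) that the period `P` and the index `I` of `C` satisfy the divisibilities
`P ∣ I ∣ P²`" (Clark–Sharif §1.3 eq. (1); the first is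
`Literature.NumberTheory.EllipticCurves.addOrderOf_dvd_index`). From `index_dvd_sq_of_zsmul_eq_zero`
with `n = P(η) = addOrderOf η > 0` (`Literature.NumberTheory.EllipticCurves.galH1_addOrderOf_pos`).
This is the hypothesis `hIP` of
`Literature.NumberTheory.EllipticCurves.ClarkSharif2010_thm2_of_primePow_torsion_index`.
[cite: ClarkSharif2010, §1.3 eq. (1)] -/
theorem index_dvd_addOrderOf_sq [W.IsElliptic] (η : W.galH1) : index W η ∣ addOrderOf η ^ 2 := by
  have hP : 0 < addOrderOf η := galH1_addOrderOf_pos W η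
  refine index_dvd_sq_of_zsmul_eq_zero W (by exact_mod_cast hP.ne') ?_
  rw [natCast_zsmul]
  exact addOrderOf_nsmul_eq_zero η

/-- **`P ∣ I ∣ P²`** for every class of `H¹(K, E)`, `E` an elliptic curve over a number field
(`Literature.NumberTheory.EllipticCurves.addOrderOf_dvd_index` and `index_dvd_addOrderOf_sq`).
[cite: ClarkSharif2010, §1.3 eq. (1)] -/
theorem addOrderOf_dvd_index_dvd_sq [W.IsElliptic] (η : W.galH1) :
    addOrderOf η ∣ index W η ∧ index W η ∣ addOrderOf η ^ 2 :=
  ⟨addOrderOf_dvd_index W η, index_dvd_addOrderOf_sq W η⟩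

end NumberField

/-- **Clark–Sharif 2010, Theorem 2 from its prime-power torsion/index form, with `I ∣ P²`
discharged**: `Literature.NumberTheory.EllipticCurves.ClarkSharif2010_thm2_of_primePow_torsion_index`
with its first hypothesis `hIP` (`I ∣ P²`, §1.3 eq. (1)) supplied by `index_dvd_addOrderOf_sq`.
[cite: ClarkSharif2010, §3.6 (first paragraph) with §1.3 (1)] -/
theorem ClarkSharif2010_thm2_of_primePow_torsion_index'
    (h : ∀ {K : Type u} [Field K] [NumberField K] (W : WeierstrassCurve K) [W.IsElliptic]
      (p n : ℕ), p.Prime → 0 < n →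
        ∀ (S : Finset (IsDedekindDomain.HeightOneSpectrum (NumberField.RingOfIntegers K)))
          (T : Finset (NumberField.InfinitePlace K)),
          ∃ ξ : ℕ → W.galH1, ξ 0 = 0 ∧ (∀ i, p ^ n • ξ i = 0) ∧
            (∀ i, ∀ v ∈ S, ξ i ∈ W.localRestrictionKer (v.adicCompletion K)) ∧
            (∀ i, ∀ w ∈ T, ξ i ∈ W.localRestrictionKer w.Completion) ∧
            ∀ i j, i ≠ j → index W (ξ i - ξ j) = (p ^ n) ^ 2) :
    ClarkSharif2010_thm2.{u} :=
  ClarkSharif2010_thm2_of_primePow_torsion_index (fun W _ η ↦ index_dvd_addOrderOf_sq W η) h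

/-! ### Cassels' theorem reduced to the existence of a rational divisor of degree `P` -/

/-- **Cassels' `I = P` on `Ш` from rational divisors of degree `p^a` on Selmer torsors.** The
named fact `Literature.NumberTheory.EllipticCurves.Cassels1962_index_eq_period_of_mem_sha` follows
from: *for every elliptic curve `E` over a number field `K`, every prime power `n = p^a` and every
`ξ ∈ Sel^(n)(E/K)`, the torsor of (some cocycle `c` representing the image of) `ξ` carries a
`K`-rational effective divisor of degree `n`* — a multiset `D` of `n` points of `E(K̄)` invariant
under `σ ⋆ Q = σ Q + c(σ)`. Indeed such a divisor gives `I ∣ n` (`index_dvd_card_of_twistInvariant`),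
which is the Selmer form of Cassels' theorem at prime-power level
(`Literature.NumberTheory.EllipticCurves.Cassels1962_index_eq_period_of_mem_sha_of_selmer_isPrimePow`).
The hypothesis is exactly what both printed proofs produce — Clark 2006, Prop. 6: for
`η ∈ 𝒦(K, E) ⊇ Ш(K, E)` "every rational divisor class on `C` admits a rational divisor", applied
to the rational divisor class of degree `n = P(η)`; equivalently O'Neil's (a): `Δ(ξ) = 0`, forced
for Selmer `ξ` by `Δ(ξ)_v = 0` at all `v` and the reciprocity law for `Br(K)` — and it is the
part that needs the Brauer group of a number field (not in Mathlib or the tree); it is spelled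
out as a hypothesis, not vendored as a named fact (D-0026).
[cite: Clark2006Crelle, Prop. 6 (both proofs) with Prop. 5(a)] [cite: ClarkSharif2010, §3.7 (ii)] -/
theorem Cassels1962_index_eq_period_of_mem_sha_of_exists_rationalDivisor
    (h : ∀ {K : Type u} [Field K] [NumberField K] (W : WeierstrassCurve K) [W.IsElliptic] {n : ℕ},
      IsPrimePow n → ∀ ξ ∈ W.selmerGroup n,
        ∃ (c : contOneCocycles (discreteTopRep (Field.absoluteGaloisGroup K) (WeierstrassCurve.geomPoints W)))
          (D : Multiset (WeierstrassCurve.geomPoints W)),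
          oneCocycleClass _ c = W.torsionH1ToH1 n ξ ∧ Multiset.card D = n ∧
            ∀ (g : Field.absoluteGaloisGroup K) (Q : WeierstrassCurve.geomPoints W),
              D.count (g • Q + c.1 g) = D.count Q) :
    Cassels1962_index_eq_period_of_mem_sha.{u} := by
  refine Cassels1962_index_eq_period_of_mem_sha_of_selmer_isPrimePow fun W _ n hn ξ hξ ↦ ?_
  obtain ⟨c, D, hc, hD, hinv⟩ := h W hn ξ hξ
  rw [← hc, ← hD]
  exact index_dvd_card_of_twistInvariant W D hinv

end Literature.NumberTheory.EllipticCurves
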